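import Summits.HubbardSuperconductivity.HubbardSuperconductivity.Theorems.BalabanIRBirComplexStableXYRHolonomyTheta
import Literature.MathematicalPhysics.QuantumFieldTheory.TorusChartCombGauge
import HarnessLib

/-!
# Crux `BirComplexStableXYR` (stmt-HubbardSuperconductivity-14845), line `fat-gaussian-defect-calculus`, chapter 2
# §2.1: flux sectors at fixed vorticity — shifted theta structure, and uniqueness of the stiffness matrix

Support file (prover seat 1, route BalabanIR; item G2 "Coulomb strain σ_a", sector organisation).

The sectors of lead c7's representation are labelled by `(q, h) = (d₁ a, wind a)` (B4).  `…HolonomyTheta` treated the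
vortex-free sectors `a = seam h`; this file treats the flux dependence AT FIXED VORTICITY `q`:

* `vfs_sub_eq_seam` — two tree-gauge cochains with the same curl differ by the seam cochain of the winding difference,
  `a − b = seam (wind a − wind b)` (sector labelling, `TorusChart.eq_of_comb_of_d₁_eq_of_wind_eq`);
* `vfs_symm_eq_of_intQuad_eq` — a symmetric real matrix is determined by its quadratic form on INTEGER vectors
  (so the existentially produced stiffness matrices of `stub_holonomyQuadraticForm`, `stub_fluxThetaPositive` and of the
  stub below are all the same matrix);
* **`stub_fixedVorticityFlux`** (registered stub): for ANY strain map `σ` with the two properties of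
  `FSUnfolding.stub_fsRepresentation` there is a symmetric `S` (the stiffness matrix: `𝒬(σ(seam h)) = hᵀSh` on `ℤ³`) such
  that for every reference sector `b` there is a real vector `ℓ_b` (`= B(σ b, σ(seam e_i))`) with, for every sector `a`
  of the same vorticity (`d₁ a = d₁ b`), writing `Δ = wind a − wind b`:
  `σ a = σ b + σ(seam Δ)` and `𝒬(σ a) = 𝒬(σ b) + 2 Σ_i ℓ_{b,i} Δ_i + Σ_{ij} S_{ij} Δ_i Δ_j`
  — at fixed vorticity the Gaussian flux weights `exp(−(K/2)𝒬)` form a SHIFTED theta series with the universal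
  stiffness matrix `S` (positive definite by `stub_fluxThetaPositive`) and a `q`-dependent real linear shift.

No definitions; sorry-free. [folklore: Fröhlich–Spencer, CMP 81 (1981) §3]
-/

noncomputable section

namespace Summit.HubbardSuperconductivity.HubbardSuperconductivity.Theorems

set_option linter.dupNamespace false -- summit = problem name (single-conjunct summit), D-0017

open scoped BigOperators ComplexConjugate
open Complex Summit.HubbardSuperconductivity.BirComplexStableXYNegative
open Literature.Probability.LatticeModels Literature.MathematicalPhysics.QuantumFieldTheory

section VortexFluxStructure

variable {r : ℕ} {L M : ℕ} [NeZero L] [NeZero M]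

/-- The quadratic form of a matrix at a unit vector is the diagonal entry. [folklore] -/
theorem vfs_quad_single {n : ℕ} (S : Fin n → Fin n → ℝ) (i : Fin n) :
    ∑ k : Fin n, ∑ l : Fin n, S k l * (((Pi.single i (1 : ℤ) : Fin n → ℤ) k : ℤ) : ℝ)
        * (((Pi.single i (1 : ℤ) : Fin n → ℤ) l : ℤ) : ℝ) = S i i := by
  simp only [Pi.single_apply, Int.cast_ite, Int.cast_one, Int.cast_zero, mul_ite, mul_one, mul_zero,
    Finset.sum_ite_eq', Finset.mem_univ, if_true]

/-- The quadratic form at a sum of two unit vectors. [folklore] -/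
theorem vfs_quad_single_add {n : ℕ} (S : Fin n → Fin n → ℝ) (i j : Fin n) :
    ∑ k : Fin n, ∑ l : Fin n, S k l
        * (((Pi.single i (1 : ℤ) : Fin n → ℤ) k + (Pi.single j (1 : ℤ) : Fin n → ℤ) k : ℤ) : ℝ)
        * (((Pi.single i (1 : ℤ) : Fin n → ℤ) l + (Pi.single j (1 : ℤ) : Fin n → ℤ) l : ℤ) : ℝ)
      = S i i + S j j + S i j + S j i := by
  have hexp : ∀ k l : Fin n, S k l
        * (((Pi.single i (1 : ℤ) : Fin n → ℤ) k + (Pi.single j (1 : ℤ) : Fin n → ℤ) k : ℤ) : ℝ)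
        * (((Pi.single i (1 : ℤ) : Fin n → ℤ) l + (Pi.single j (1 : ℤ) : Fin n → ℤ) l : ℤ) : ℝ)
      = S k l * (((Pi.single i (1 : ℤ) : Fin n → ℤ) k : ℤ) : ℝ) * (((Pi.single i (1 : ℤ) : Fin n → ℤ) l : ℤ) : ℝ)
        + S k l * (((Pi.single j (1 : ℤ) : Fin n → ℤ) k : ℤ) : ℝ) * (((Pi.single j (1 : ℤ) : Fin n → ℤ) l : ℤ) : ℝ)
        + S k l * (((Pi.single i (1 : ℤ) : Fin n → ℤ) k : ℤ) : ℝ) * (((Pi.single j (1 : ℤ) : Fin n → ℤ) l : ℤ) : ℝ)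
        + S k l * (((Pi.single j (1 : ℤ) : Fin n → ℤ) k : ℤ) : ℝ) * (((Pi.single i (1 : ℤ) : Fin n → ℤ) l : ℤ) : ℝ) := by
    intro k l; push_cast; ring
  simp only [hexp, Finset.sum_add_distrib, vfs_quad_single]
  have hcross : ∀ i' j' : Fin n, ∑ k : Fin n, ∑ l : Fin n,
      S k l * (((Pi.single i' (1 : ℤ) : Fin n → ℤ) k : ℤ) : ℝ) * (((Pi.single j' (1 : ℤ) : Fin n → ℤ) l : ℤ) : ℝ)
        = S i' j' := by
    intro i' j'
    simp only [Pi.single_apply, Int.cast_ite, Int.cast_one, Int.cast_zero, mul_ite, mul_one, mul_zero,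
      Finset.sum_ite_eq', Finset.mem_univ, if_true]
  rw [hcross i j, hcross j i]

/-- **A symmetric real matrix is determined by its quadratic form on integer vectors.** [folklore] -/
theorem vfs_symm_eq_of_intQuad_eq {n : ℕ} {S S' : Fin n → Fin n → ℝ} (hS : ∀ i j, S i j = S j i)
    (hS' : ∀ i j, S' i j = S' j i)
    (h : ∀ v : Fin n → ℤ, ∑ k : Fin n, ∑ l : Fin n, S k l * (v k : ℝ) * (v l : ℝ)
      = ∑ k : Fin n, ∑ l : Fin n, S' k l * (v k : ℝ) * (v l : ℝ)) :
    S = S' := by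
  have hdiag : ∀ i, S i i = S' i i := by
    intro i
    have hi := h (Pi.single i (1 : ℤ))
    rwa [vfs_quad_single, vfs_quad_single] at hi
  funext i j
  by_cases hij : i = j
  · subst hij; exact hdiag i
  · have hq := h ((Pi.single i (1 : ℤ) : Fin n → ℤ) + (Pi.single j (1 : ℤ) : Fin n → ℤ))
    simp only [Pi.add_apply] at hq
    rw [vfs_quad_single_add S i j, vfs_quad_single_add S' i j, hdiag i, hdiag j, ← hS i j, ← hS' i j] at hq
    linarith

/-- **Same vorticity ⇒ the difference is a seam cochain**: two tree-gauge integer cochains with the same curl differ by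
`seam (wind a − wind b)`. [folklore] -/
theorem vfs_sub_eq_seam
    (a b : {a : Λ L M → Fin 3 → ℤ // ∀ (y : Λ L M) (μ : Fin 3),
      (∀ ν : Fin 3, μ < ν → (TorusChart.piProdZMod 2 L M).cval ν y = 0) →
      (TorusChart.piProdZMod 2 L M).cval μ y + 1 < (TorusChart.piProdZMod 2 L M).period μ → a y μ = 0})
    (hd : (TorusChart.piProdZMod 2 L M).d₁ a.1 = (TorusChart.piProdZMod 2 L M).d₁ b.1) :
    a.1 - b.1 = (TorusChart.piProdZMod 2 L M).seam
      ((TorusChart.piProdZMod 2 L M).wind a.1 - (TorusChart.piProdZMod 2 L M).wind b.1) := by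
  refine (TorusChart.piProdZMod 2 L M).eq_of_comb_of_d₁_eq_of_wind_eq
    (fun x μ hx => by rw [Pi.sub_apply, Pi.sub_apply, a.2 x μ hx.1 hx.2, b.2 x μ hx.1 hx.2, sub_zero])
    (fun x μ hx => (TorusChart.piProdZMod 2 L M).seam_of_lt _ x μ hx.2) ?_ ?_
  · rw [(TorusChart.piProdZMod 2 L M).d₁_sub, hd, sub_self, (TorusChart.piProdZMod 2 L M).d₁_seam]
  · rw [(TorusChart.piProdZMod 2 L M).wind_sub, (TorusChart.piProdZMod 2 L M).wind_seam]

/-- **Registered stub `stub_fixedVorticityFlux` (prover seat 1 on stmt-HubbardSuperconductivity-14845; chapter 2 §2.1):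
flux sectors at fixed vorticity form a shifted theta series with the universal stiffness matrix.**  Hypotheses as in
`stub_holonomyQuadraticForm`.  Conclusion: a symmetric `S` with `𝒬(σ(seam h)) = Σ S_{ij} h_i h_j` on `ℤ³` (this pins
`S`, `vfs_symm_eq_of_intQuad_eq`) such that every reference sector `b` has a real vector `ℓ` with, for every `a` of
the same vorticity `d₁ a = d₁ b`, `σ a = σ b + σ(seam (wind a − wind b))` and
`𝒬(σ a) = 𝒬(σ b) + 2 Σ_i ℓ_i (wind a − wind b)_i + Σ_{ij} S_{ij} (wind a − wind b)_i (wind a − wind b)_j`. [folklore] -/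
theorem stub_fixedVorticityFlux : ∀ (r : ℕ) (c : Table r) (c₀ : ℝ), 2 ≤ r → 0 < c₀ → c.sum (fun _ a => a) = 0 → (∀ φ : W r → ℝ, c₀ * ∑ w, ∑ w', (1 - Real.cos (φ w - φ w')) ≤ (genF c φ).re) → ∀ (L M : ℕ) [NeZero L] [NeZero M] (P : (Λ L M → Fin 3 → ℝ) → Λ L M → W r → ℝ), (∀ (ω : Λ L M → Fin 3 → ℝ) (s : Λ L M) (w : W r), P ω s w = (TorusChart.piProdZMod 2 L M).lineSum ω 0 (w.1 : ℕ) s + (TorusChart.piProdZMod 2 L M).lineSum ω 1 (w.2.1 : ℕ) (s + (w.1 : ℕ) • (TorusChart.piProdZMod 2 L M).gen 0) + (TorusChart.piProdZMod 2 L M).lineSum ω 2 (w.2.2 : ℕ) (s + (w.1 : ℕ) • (TorusChart.piProdZMod 2 L M).gen 0 + (w.2.1 : ℕ) • (TorusChart.piProdZMod 2 L M).gen 1)) → ∀ (Q : (W r → ℝ) → ℝ), (∀ u : W r → ℝ, Q u = (-c.sum (fun n a => a * (((∑ w, (n w : ℝ) * u w) ^ 2 : ℝ) : ℂ))).re) →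 ∀ (σ : {a : Λ L M → Fin 3 → ℤ // ∀ (y : Λ L M) (μ : Fin 3), (∀ ν : Fin 3, μ < ν → (TorusChart.piProdZMod 2 L M).cval ν y = 0) → (TorusChart.piProdZMod 2 L M).cval μ y + 1 < (TorusChart.piProdZMod 2 L M).period μ → a y μ = 0} → (Λ L M → Fin 3 → ℝ)), (∀ a, ∃ ψ : Λ L M → ℝ, σ a = fun x i => 2 * Real.pi * (a.1 x i : ℝ) - (TorusChart.piProdZMod 2 L M).d₀ ψ x i) → (∀ a (u : Λ L M → ℝ), ∑ s : Λ L M, Q (P (fun x i => (TorusChart.piProdZMod 2 L M).d₀ u x i - σ a x i) s) = ∑ s : Λ L M, Q (P ((TorusChart.piProdZMod 2 L M).d₀ u) s) + ∑ s : Λ L M, Q (P (σ a) s)) → ∃ S : Fin 3 → Fin 3 → ℝ, (∀ i j, S i j = S j i) ∧ (∀ h : Fin 3 → ℤ, ∑ s : Λ L M, Q (P (σ ⟨(TorusChart.piProdZMod 2 L M).seam h, fun y μ _ hμ => (TorusChart.piProdZMod 2 L M).seam_of_lt h y μ hμ⟩) s) = ∑ i : Fin 3, ∑ j : Fin 3,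 S i j * (h i : ℝ) * (h j : ℝ)) ∧ (∀ b : {a : Λ L M → Fin 3 → ℤ // ∀ (y : Λ L M) (μ : Fin 3), (∀ ν : Fin 3, μ < ν → (TorusChart.piProdZMod 2 L M).cval ν y = 0) → (TorusChart.piProdZMod 2 L M).cval μ y + 1 < (TorusChart.piProdZMod 2 L M).period μ → a y μ = 0}, ∃ ℓ : Fin 3 → ℝ, ∀ a : {a : Λ L M → Fin 3 → ℤ // ∀ (y : Λ L M) (μ : Fin 3), (∀ ν : Fin 3, μ < ν → (TorusChart.piProdZMod 2 L M).cval ν y = 0) → (TorusChart.piProdZMod 2 L M).cval μ y + 1 < (TorusChart.piProdZMod 2 L M).period μ → a y μ = 0}, (TorusChart.piProdZMod 2 L M).d₁ a.1 = (TorusChart.piProdZMod 2 L M).d₁ b.1 → σ a = σ b + σ ⟨(TorusChart.piProdZMod 2 L M).seam ((TorusChart.piProdZMod 2 L M).wind a.1 - (TorusChart.piProdZMod 2 L M).wind b.1), fun y μ _ hμ => (TorusChart.piProdZMod 2 L M).seam_of_lt _ y μ hμ⟩ ∧ ∑ s : Λ L M, Q (P (σ a) s) = ∑ s : Λ L M,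 Q (P (σ b) s) + 2 * ∑ i : Fin 3, ℓ i * (((TorusChart.piProdZMod 2 L M).wind a.1 - (TorusChart.piProdZMod 2 L M).wind b.1) i : ℝ) + ∑ i : Fin 3, ∑ j : Fin 3, S i j * (((TorusChart.piProdZMod 2 L M).wind a.1 - (TorusChart.piProdZMod 2 L M).wind b.1) i : ℝ) * (((TorusChart.piProdZMod 2 L M).wind a.1 - (TorusChart.piProdZMod 2 L M).wind b.1) j : ℝ)) := by
  intro r c c₀ hr hc₀ hA hC L M _ _ P hP Q hQ σ hcls hpy
  obtain ⟨B, hBsymm, hBdiag⟩ := FSUnfolding.stub_thinFormPolar r c L M P hP Q hQ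
  obtain ⟨hadd, _, _⟩ := stub_strainAdditive r c c₀ hr hc₀ hA hC L M P hP Q hQ σ hcls hpy
  -- unit strains and the stiffness matrix
  have hsum : ∀ h : Fin 3 → ℤ, σ ⟨(TorusChart.piProdZMod 2 L M).seam h, hth_seam_comb h⟩
      = ∑ i : Fin 3, (h i : ℝ) • σ ⟨(TorusChart.piProdZMod 2 L M).seam (Pi.single i (1 : ℤ)),
          hth_seam_comb (Pi.single i (1 : ℤ))⟩ :=
    fun h => hth_strain_seam_eq_sum c hr hc₀ hA hC P hP Q hQ σ hcls hpy h
  have hquad : ∀ h : Fin 3 → ℤ, ∑ s : Λ L M, Q (P (σ ⟨(TorusChart.piProdZMod 2 L M).seam h, hth_seam_comb h⟩) s)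
      = ∑ i : Fin 3, ∑ j : Fin 3,
          B (σ ⟨(TorusChart.piProdZMod 2 L M).seam (Pi.single i (1 : ℤ)), hth_seam_comb (Pi.single i (1 : ℤ))⟩)
            (σ ⟨(TorusChart.piProdZMod 2 L M).seam (Pi.single j (1 : ℤ)), hth_seam_comb (Pi.single j (1 : ℤ))⟩)
          * (h i : ℝ) * (h j : ℝ) := by
    intro h
    rw [← hBdiag, hsum h]
    exact hth_bilin_expand B _ _
  refine ⟨fun i j => B (σ ⟨(TorusChart.piProdZMod 2 L M).seam (Pi.single i (1 : ℤ)), hth_seam_comb (Pi.single i (1 : ℤ))⟩)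
      (σ ⟨(TorusChart.piProdZMod 2 L M).seam (Pi.single j (1 : ℤ)), hth_seam_comb (Pi.single j (1 : ℤ))⟩),
    fun i j => hBsymm _ _, fun h => hquad h, fun b => ?_⟩
  refine ⟨fun i => B (σ b) (σ ⟨(TorusChart.piProdZMod 2 L M).seam (Pi.single i (1 : ℤ)), hth_seam_comb (Pi.single i (1 : ℤ))⟩),
    fun a hd => ?_⟩
  -- `a = b + (a - b)` in the comb-vanishing cochains, and `a - b = seam Δ`
  set Δ : Fin 3 → ℤ := (TorusChart.piProdZMod 2 L M).wind a.1 - (TorusChart.piProdZMod 2 L M).wind b.1 with hΔ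
  have hsub := vfs_sub_eq_seam a b hd
  have hmemab : ∀ (y : Λ L M) (μ : Fin 3), (∀ ν : Fin 3, μ < ν → (TorusChart.piProdZMod 2 L M).cval ν y = 0) →
      (TorusChart.piProdZMod 2 L M).cval μ y + 1 < (TorusChart.piProdZMod 2 L M).period μ → (a.1 - b.1) y μ = 0 :=
    fun y μ hν hμ => by rw [Pi.sub_apply, Pi.sub_apply, a.2 y μ hν hμ, b.2 y μ hν hμ, sub_zero]
  have hdecomp : σ a = σ b + σ ⟨(TorusChart.piProdZMod 2 L M).seam Δ, hth_seam_comb Δ⟩ := by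
    have h1 := hadd b ⟨a.1 - b.1, hmemab⟩
    have h2 : (⟨b.1 + (a.1 - b.1), fun y μ hν hμ => by
        rw [Pi.add_apply, Pi.add_apply, b.2 y μ hν hμ, hmemab y μ hν hμ, add_zero]⟩ :
        {a : Λ L M → Fin 3 → ℤ // ∀ (y : Λ L M) (μ : Fin 3),
          (∀ ν : Fin 3, μ < ν → (TorusChart.piProdZMod 2 L M).cval ν y = 0) →
          (TorusChart.piProdZMod 2 L M).cval μ y + 1 < (TorusChart.piProdZMod 2 L M).period μ → a y μ = 0}) = a :=
      Subtype.ext (add_sub_cancel b.1 a.1)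
    have h3 : (⟨a.1 - b.1, hmemab⟩ :
        {a : Λ L M → Fin 3 → ℤ // ∀ (y : Λ L M) (μ : Fin 3),
          (∀ ν : Fin 3, μ < ν → (TorusChart.piProdZMod 2 L M).cval ν y = 0) →
          (TorusChart.piProdZMod 2 L M).cval μ y + 1 < (TorusChart.piProdZMod 2 L M).period μ → a y μ = 0})
        = ⟨(TorusChart.piProdZMod 2 L M).seam Δ, hth_seam_comb Δ⟩ :=
      Subtype.ext hsub
    rw [h2, h3] at h1
    exact h1
  have hmem : (⟨(TorusChart.piProdZMod 2 L M).seam Δ, fun y μ _ hμ => (TorusChart.piProdZMod 2 L M).seam_of_lt _ y μ hμ⟩ :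
      {a : Λ L M → Fin 3 → ℤ // ∀ (y : Λ L M) (μ : Fin 3),
        (∀ ν : Fin 3, μ < ν → (TorusChart.piProdZMod 2 L M).cval ν y = 0) →
        (TorusChart.piProdZMod 2 L M).cval μ y + 1 < (TorusChart.piProdZMod 2 L M).period μ → a y μ = 0})
      = ⟨(TorusChart.piProdZMod 2 L M).seam Δ, hth_seam_comb Δ⟩ := rfl
  refine ⟨by rw [hmem]; exact hdecomp, ?_⟩
  -- the quadratic expansion
  set w : Λ L M → Fin 3 → ℝ := σ ⟨(TorusChart.piProdZMod 2 L M).seam Δ, hth_seam_comb Δ⟩ with hw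
  have hwsum : w = ∑ i : Fin 3, (Δ i : ℝ) • σ ⟨(TorusChart.piProdZMod 2 L M).seam (Pi.single i (1 : ℤ)),
      hth_seam_comb (Pi.single i (1 : ℤ))⟩ := hsum Δ
  have hQa : ∑ s : Λ L M, Q (P (σ a) s) = B (σ b) (σ b) + 2 * B (σ b) w + B w w := by
    rw [← hBdiag, hdecomp]
    simp only [map_add, LinearMap.add_apply]
    rw [hBsymm w (σ b)]
    ring
  rw [hQa, hBdiag, ← hquad Δ, ← hBdiag w]
  congr 1
  congr 1
  rw [hwsum, map_sum]
  congr 1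
  refine Finset.sum_congr rfl fun i _ => ?_
  rw [map_smul, smul_eq_mul, mul_comm]

end VortexFluxStructure

end Summit.HubbardSuperconductivity.HubbardSuperconductivity.Theorems

end
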